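import Summits.HodgeConjecture.HodgeConjecture.Theorems.CyclicUnitaryPowersCommutatorIdentity

/-!
# Commutator invariance ascends from `ℚ`-points to `K`-points (Cayley parameters, part 3 of 3)

Helper for the crux `PowersHodgeOfDeckCommutators` (stmt-HodgeConjecture-19545, route `CyclicUnitaryPowers`,
line `unitary-kunneth-fft`, stub U `stub_unitaryHodgeTensorFFT`): the DENSITY step of the unitary tensor FFT,
done with Cayley parameters instead of Zariski closures.

Data: rational matrices `S` (the deck transformation, `S ^ p = 1`) and `G` (a symmetric nondegenerate Gram
matrix with `Sᵀ G S = G`), and a rational coefficient tensor `c` on words `Fin r → Fin N` (coordinates of a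
tensor in `V^{⊗r}`, cf. `SymplecticInvolutionTensorFFT.coord_invariant`).  Hypothesis: `c` is fixed by the
Kronecker power (`tensorPowerMatrix`) of every COMMUTATOR `g h g⁻¹ h⁻¹` of invertible rational matrices `g, h`
commuting with `S` and preserving `G`.  Conclusion (`commutator_invariance_ascends`): for every field `K` of
characteristic zero, `c` is fixed by the Kronecker power of `g h g⁻¹ h⁻¹` for all `K`-matrices `g, h` commuting
with `S`, preserving `G`, and with `det (1 + g)`, `det (1 + h)` invertible — the Cayley-parametrised part of the
centraliser-isometry group (the bootstrapping from there to all commutators, `Ω·Ω = U°`, is group theory left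
to the consumer).

Proof (Goodman–Wallach, GTM 255, Exercises 1.4.5 #5 and §2.2.3 Exercise 1 «Cayley parameters»; Weyl's
principle of irrelevance of algebraic inequalities): §1 every such `g` is the Cayley transform of its Cayley
section `X = (1 - g)(1 + g)⁻¹`, which commutes with `S`, is `G`-skew, and has `det(1 ± X)` invertible; §2 with
`A = (2p)⁻¹ • X`, `B = (2p)⁻¹ • Y` one has `ρ A = X`, `ρ B = Y` (part 1, `rho_of_mem`), so the generic identity
of part 2 (`innerPoly_eq_zero`), evaluated at `(A, B)`, reads `uDen^r • ((g h g⁻¹ h⁻¹)^{⊗r} c) = uDen^r • c`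
with `uDen ≠ 0`.
-/

noncomputable section

open Matrix MvPolynomial
open scoped BigOperators

namespace Summit.HodgeConjecture.HodgeConjecture.Theorems.CyclicUnitaryPowersCommutatorAscent

open Summit.HodgeConjecture.HodgeConjecture.Theorems.CyclicUnitaryPowersCayleyParameters
open Summit.HodgeConjecture.HodgeConjecture.Theorems.CyclicUnitaryPowersCommutatorIdentity

/-! ### §1 The `K`-points: every Cayley-parametrised centraliser isometry is reached -/

section KPoints

open Literature.NumberTheory.DiophantineGeometry (tensorPowerMatrix tensorPowerMatrix_apply)

variable {K : Type*} [Field K] {N : ℕ}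

/-- The Cayley section `g ↦ (1 - g)(1 + g)⁻¹`: `1 + X = 2 • (1+g)⁻¹`. [cite: GoodmanWallachGTM255, §2.2.3 Exercise 1 (a)] -/
theorem one_add_section (g : Matrix (Fin N) (Fin N) K) (hg1 : IsUnit (1 + g).det) :
    1 + (1 - g) * (1 + g)⁻¹ = (2 : K) • (1 + g)⁻¹ := by
  have h2 : (1 + g) + (1 - g) = (2 : K) • (1 : Matrix (Fin N) (Fin N) K) := by rw [two_smul]; abel
  calc 1 + (1 - g) * (1 + g)⁻¹ = (1 + g) * (1 + g)⁻¹ + (1 - g) * (1 + g)⁻¹ := by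
        rw [Matrix.mul_nonsing_inv _ hg1]
    _ = ((1 + g) + (1 - g)) * (1 + g)⁻¹ := by rw [← Matrix.add_mul]
    _ = (2 : K) • (1 + g)⁻¹ := by rw [h2, Matrix.smul_mul, Matrix.one_mul]

/-- The Cayley section: `1 - X = 2 • g (1+g)⁻¹`. [cite: GoodmanWallachGTM255, §2.2.3 Exercise 1 (a)] -/
theorem one_sub_section (g : Matrix (Fin N) (Fin N) K) (hg1 : IsUnit (1 + g).det) :
    1 - (1 - g) * (1 + g)⁻¹ = (2 : K) • (g * (1 + g)⁻¹) := by
  have h2 : (1 + g) - (1 - g) = (2 : K) • g := by rw [two_smul]; abel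
  calc 1 - (1 - g) * (1 + g)⁻¹ = (1 + g) * (1 + g)⁻¹ - (1 - g) * (1 + g)⁻¹ := by
        rw [Matrix.mul_nonsing_inv _ hg1]
    _ = ((1 + g) - (1 - g)) * (1 + g)⁻¹ := by rw [← Matrix.sub_mul]
    _ = (2 : K) • (g * (1 + g)⁻¹) := by rw [h2, Matrix.smul_mul]

variable [CharZero K]

/-- `det (1 + X)` is a unit for the Cayley section `X`. [cite: GoodmanWallachGTM255, §2.2.3 Exercise 1 (a)] -/
theorem isUnit_det_one_add_section (g : Matrix (Fin N) (Fin N) K) (hg1 : IsUnit (1 + g).det) :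
    IsUnit (1 + (1 - g) * (1 + g)⁻¹).det := by
  rw [one_add_section g hg1, det_smul]
  exact (IsUnit.pow _ (isUnit_iff_ne_zero.mpr two_ne_zero)).mul (Matrix.isUnit_nonsing_inv_det _ hg1)

/-- `det (1 - X)` is a unit for the Cayley section `X` (when `g` is invertible).
[cite: GoodmanWallachGTM255, §2.2.3 Exercise 1 (a)] -/
theorem isUnit_det_one_sub_section (g : Matrix (Fin N) (Fin N) K) (hg1 : IsUnit (1 + g).det) (hgd : IsUnit g.det) :
    IsUnit (1 - (1 - g) * (1 + g)⁻¹).det := by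
  rw [one_sub_section g hg1, det_smul, det_mul]
  exact (IsUnit.pow _ (isUnit_iff_ne_zero.mpr two_ne_zero)).mul (hgd.mul (Matrix.isUnit_nonsing_inv_det _ hg1))

/-- The Cayley transform of the Cayley section of `g` is `g`. [cite: GoodmanWallachGTM255, §2.2.3 Exercise 1 (a)] -/
theorem cayley_section (g : Matrix (Fin N) (Fin N) K) (hg1 : IsUnit (1 + g).det) :
    cayley ((1 - g) * (1 + g)⁻¹) = g := by
  have h1 := isUnit_det_one_add_section g hg1
  have hmul : g * (1 + (1 - g) * (1 + g)⁻¹) = 1 - (1 - g) * (1 + g)⁻¹ := by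
    rw [one_add_section g hg1, one_sub_section g hg1, Matrix.mul_smul]
  unfold cayley
  rw [← hmul, Matrix.mul_assoc, Matrix.mul_nonsing_inv _ h1, Matrix.mul_one]

omit [CharZero K] in
/-- The Cayley section of a `g` commuting with `S` commutes with `S`. [cite: GoodmanWallachGTM255, §2.2.3 Exercise 1 (b)] -/
theorem section_comm {S : Matrix (Fin N) (Fin N) K} (g : Matrix (Fin N) (Fin N) K) (hg1 : IsUnit (1 + g).det)
    (hgS : g * S = S * g) : (1 - g) * (1 + g)⁻¹ * S = S * ((1 - g) * (1 + g)⁻¹) := by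
  have h1 : (1 + g) * S = S * (1 + g) := by rw [add_mul, mul_add, one_mul, mul_one, hgS]
  have h2 : (1 - g) * S = S * (1 - g) := by rw [sub_mul, mul_sub, one_mul, mul_one, hgS]
  have hinv : (1 + g)⁻¹ * S = S * (1 + g)⁻¹ := by
    calc (1 + g)⁻¹ * S = (1 + g)⁻¹ * S * ((1 + g) * (1 + g)⁻¹) := by
          rw [Matrix.mul_nonsing_inv _ hg1, Matrix.mul_one]
      _ = (1 + g)⁻¹ * ((1 + g) * S) * (1 + g)⁻¹ := by rw [h1]; simp only [Matrix.mul_assoc]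
      _ = S * (1 + g)⁻¹ := by rw [← Matrix.mul_assoc, Matrix.nonsing_inv_mul _ hg1, Matrix.one_mul]
  rw [Matrix.mul_assoc, hinv, ← Matrix.mul_assoc, h2, Matrix.mul_assoc]

omit [CharZero K] in
/-- The Cayley section of a `G`-isometry is `G`-skew. [cite: GoodmanWallachGTM255, Exercises 1.4.5 #5 (a)] -/
theorem section_skew {G : Matrix (Fin N) (Fin N) K} (g : Matrix (Fin N) (Fin N) K) (hg1 : IsUnit (1 + g).det)
    (hgG : gᵀ * G * g = G) :
    ((1 - g) * (1 + g)⁻¹)ᵀ * G + G * ((1 - g) * (1 + g)⁻¹) = 0 := by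
  have hut : IsUnit (1 + g)ᵀ.det := by rwa [det_transpose]
  have hXu : (1 - g) * (1 + g)⁻¹ * (1 + g) = 1 - g := by
    rw [Matrix.mul_assoc, Matrix.nonsing_inv_mul _ hg1, Matrix.mul_one]
  generalize (1 - g) * (1 + g)⁻¹ = X at hXu ⊢
  have huX : (1 + g)ᵀ * Xᵀ = (1 - g)ᵀ := by rw [← transpose_mul, hXu]
  have key : (1 + g)ᵀ * (Xᵀ * G + G * X) * (1 + g) = 0 := by
    calc (1 + g)ᵀ * (Xᵀ * G + G * X) * (1 + g)
        = (1 + g)ᵀ * Xᵀ * G * (1 + g) + (1 + g)ᵀ * G * (X * (1 + g)) := by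
          rw [Matrix.mul_add (1 + g)ᵀ (Xᵀ * G) (G * X),
            Matrix.add_mul ((1 + g)ᵀ * (Xᵀ * G)) ((1 + g)ᵀ * (G * X)) (1 + g)]
          simp only [Matrix.mul_assoc]
      _ = (1 - g)ᵀ * G * (1 + g) + (1 + g)ᵀ * G * (1 - g) := by rw [huX, hXu]
      _ = 0 := by
          rw [transpose_sub, transpose_add, transpose_one]
          have hg' : gᵀ * (G * g) = G := by rw [← Matrix.mul_assoc]; exact hgG
          simp only [sub_mul, mul_sub, add_mul, mul_add, one_mul, mul_one, Matrix.mul_assoc, hg']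
          abel
  have e : Xᵀ * G + G * X = (1 + g)ᵀ⁻¹ * ((1 + g)ᵀ * (Xᵀ * G + G * X) * (1 + g)) * (1 + g)⁻¹ := by
    generalize Xᵀ * G + G * X = M
    rw [Matrix.mul_assoc (1 + g)ᵀ M (1 + g), ← Matrix.mul_assoc (1 + g)ᵀ⁻¹ (1 + g)ᵀ (M * (1 + g)),
      Matrix.nonsing_inv_mul _ hut, Matrix.one_mul, Matrix.mul_assoc M (1 + g) (1 + g)⁻¹,
      Matrix.mul_nonsing_inv _ hg1, Matrix.mul_one]
  rw [e, key, Matrix.mul_zero, Matrix.zero_mul]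

end KPoints

/-! ### §2 Main theorem -/

section Main

open Literature.NumberTheory.DiophantineGeometry (tensorPowerMatrix tensorPowerMatrix_apply)

/-- **Commutator invariance ascends from `ℚ`-points to `K`-points (Cayley-parametrised part).**
Let `S, G` be rational `N × N` matrices with `S ^ p = 1` (`p > 0`), `G` symmetric with `det G ≠ 0` and
`Sᵀ G S = G`, and let `c` be a rational coefficient tensor on words of length `r` fixed by the Kronecker power
of `g h g⁻¹ h⁻¹` for all invertible rational `g, h` commuting with `S` and preserving `G`.  Then for every
field `K` of characteristic zero and all `K`-matrices `g, h` commuting with `S`, preserving `G` and with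
`det (1 + g)`, `det (1 + h)` invertible, the Kronecker power of `g h g⁻¹ h⁻¹` fixes `c`.
[cite: GoodmanWallachGTM255, Exercises 1.4.5 #5 and §2.2.3 Exercise 1] -/
theorem commutator_invariance_ascends {N r p : ℕ} (S G : Matrix (Fin N) (Fin N) ℚ) (hp : 0 < p)
    (hSp : S ^ p = 1) (hSG : Sᵀ * G * S = G) (hGt : Gᵀ = G) (hG : IsUnit G.det)
    (c : (Fin r → Fin N) → ℚ)
    (hc : ∀ g h : Matrix (Fin N) (Fin N) ℚ, IsUnit g.det → IsUnit h.det → g * S = S * g → h * S = S * h →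
      gᵀ * G * g = G → hᵀ * G * h = G → tensorPowerMatrix ℚ N r (g * h * g⁻¹ * h⁻¹) *ᵥ c = c)
    {K : Type*} [Field K] [CharZero K] (g h : Matrix (Fin N) (Fin N) K)
    (hg1 : IsUnit (1 + g).det) (hh1 : IsUnit (1 + h).det)
    (hgS : g * S.map (algebraMap ℚ K) = S.map (algebraMap ℚ K) * g)
    (hhS : h * S.map (algebraMap ℚ K) = S.map (algebraMap ℚ K) * h)
    (hgG : gᵀ * G.map (algebraMap ℚ K) * g = G.map (algebraMap ℚ K))
    (hhG : hᵀ * G.map (algebraMap ℚ K) * h = G.map (algebraMap ℚ K)) :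
    tensorPowerMatrix K N r (g * h * g⁻¹ * h⁻¹) *ᵥ (fun w => algebraMap ℚ K (c w)) =
      fun w => algebraMap ℚ K (c w) := by
  -- the structure over `ℚ`
  have hSdet : IsUnit S.det := by
    have e := congrArg Matrix.det hSp
    rw [det_pow, det_one] at e
    exact IsUnit.of_pow_eq_one e hp.ne'
  have hSSi : S * S⁻¹ = 1 := Matrix.mul_nonsing_inv _ hSdet
  have hSiS : S⁻¹ * S = 1 := Matrix.nonsing_inv_mul _ hSdet
  have hGGi : G * G⁻¹ = 1 := Matrix.mul_nonsing_inv _ hG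
  have hGiG : G⁻¹ * G = 1 := Matrix.nonsing_inv_mul _ hG
  have hGit : (G⁻¹)ᵀ = G⁻¹ := by rw [transpose_nonsing_inv, hGt]
  -- its transport to `K`
  let φ : ℚ →+* K := algebraMap ℚ K
  have em : ∀ M : Matrix (Fin N) (Fin N) ℚ, M.map (algebraMap ℚ K) = φ.mapMatrix M := fun M => rfl
  have tmul : ∀ M M' : Matrix (Fin N) (Fin N) ℚ, M.map φ * M'.map φ = (M * M').map φ := fun M M' => by
    rw [em, em, em, ← map_mul]
  have ttr : ∀ M : Matrix (Fin N) (Fin N) ℚ, (M.map φ)ᵀ = Mᵀ.map φ := fun M => by rw [Matrix.transpose_map]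
  have tone : (1 : Matrix (Fin N) (Fin N) ℚ).map φ = 1 := by rw [em, map_one]
  have tSp : S.map φ ^ p = 1 := by rw [em, ← map_pow, hSp, map_one]
  have tSSi : S.map φ * S⁻¹.map φ = 1 := by rw [tmul, hSSi, tone]
  have tSiS : S⁻¹.map φ * S.map φ = 1 := by rw [tmul, hSiS, tone]
  have tGGi : G.map φ * G⁻¹.map φ = 1 := by rw [tmul, hGGi, tone]
  have tGiG : G⁻¹.map φ * G.map φ = 1 := by rw [tmul, hGiG, tone]
  have tSG : (S.map φ)ᵀ * G.map φ * S.map φ = G.map φ := by rw [ttr, tmul, tmul, hSG]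
  have tGt : (G.map φ)ᵀ = G.map φ := by rw [ttr, hGt]
  have tGit : (G⁻¹.map φ)ᵀ = G⁻¹.map φ := by rw [ttr, hGit]
  have tGdet : (G.map φ).det ≠ 0 := by
    rw [em, ← RingHom.map_det]; exact (hG.map φ).ne_zero
  -- `g`, `h` are invertible
  have hdet : ∀ k : Matrix (Fin N) (Fin N) K, kᵀ * G.map φ * k = G.map φ → IsUnit k.det := by
    intro k hk
    have e := congrArg Matrix.det hk
    rw [det_mul, det_mul, det_transpose] at e
    have e2 : k.det * k.det * (G.map φ).det = 1 * (G.map φ).det := by linear_combination e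
    exact IsUnit.of_mul_eq_one _ (mul_right_cancel₀ tGdet e2)
  have hgd := hdet g hgG
  have hhd := hdet h hhG
  -- the two points `A`, `B` of the parameter space with `ρ A = X`, `ρ B = Y` (Cayley sections of `g`, `h`)
  have h2p : ((2 * p : ℕ) : K) ≠ 0 := by exact_mod_cast (by omega : 2 * p ≠ 0)
  have hrho : ∀ k : Matrix (Fin N) (Fin N) K, IsUnit (1 + k).det → k * S.map φ = S.map φ * k →
      kᵀ * G.map φ * k = G.map φ →
      rho (S.map φ) (S⁻¹.map φ) (G.map φ) (G⁻¹.map φ) p (((2 * p : ℕ) : K)⁻¹ • ((1 - k) * (1 + k)⁻¹)) =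
        (1 - k) * (1 + k)⁻¹ := by
    intro k hk1 hkS hkG
    rw [rho_smul, rho_of_mem tSSi tSiS tGiG (section_comm k hk1 hkS) (section_skew k hk1 hkG),
      ← Nat.cast_smul_eq_nsmul K, smul_smul, inv_mul_cancel₀ h2p, one_smul]
  set A : Matrix (Fin N) (Fin N) K := ((2 * p : ℕ) : K)⁻¹ • ((1 - g) * (1 + g)⁻¹) with hA
  set B : Matrix (Fin N) (Fin N) K := ((2 * p : ℕ) : K)⁻¹ • ((1 - h) * (1 + h)⁻¹) with hB
  have hrA := hrho g hg1 hgS hgG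
  have hrB := hrho h hh1 hhS hhG
  rw [← hA] at hrA
  rw [← hB] at hrB
  have hXp := isUnit_det_one_add_section g hg1
  have hXm := isUnit_det_one_sub_section g hg1 hgd
  have hYp := isUnit_det_one_add_section h hh1
  have hYm := isUnit_det_one_sub_section h hh1 hhd
  -- the numerator and the denominator at `(A, B)`
  have hU : uNum (S.map φ) (S⁻¹.map φ) (G.map φ) (G⁻¹.map φ) p A B =
      uDen (S.map φ) (S⁻¹.map φ) (G.map φ) (G⁻¹.map φ) p A B • (g * h * g⁻¹ * h⁻¹) := by
    unfold uNum uDen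
    rw [hrA, hrB, commutator_numerator _ _ hXp hXm hYp hYm, cayley_section g hg1, cayley_section h hh1]
  have hD : uDen (S.map φ) (S⁻¹.map φ) (G.map φ) (G⁻¹.map φ) p A B ≠ 0 := by
    unfold uDen
    rw [hrA, hrB]
    exact mul_ne_zero (mul_ne_zero (mul_ne_zero hXp.ne_zero hYp.ne_zero) hXm.ne_zero) hYm.ne_zero
  -- evaluate the generic identity at `(A, B)`
  funext w'
  have k := aeval_innerPoly (K := K) S S⁻¹ G G⁻¹ p r c w' A B
  rw [innerPoly_eq_zero S G hp hSp hSG hGt hG c hc w', map_zero, hU, tensorPowerMatrix_smul, Matrix.smul_mulVec,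
    Pi.smul_apply, smul_eq_mul] at k
  exact mul_left_cancel₀ (pow_ne_zero r hD) (sub_eq_zero.mp k.symm)

end Main

end Summit.HodgeConjecture.HodgeConjecture.Theorems.CyclicUnitaryPowersCommutatorAscent

end
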